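import Summits.QuantumFields.YangMills.Theorems.BalabanUVNodesPortS1JacobianHoloDomainDet
import Summits.QuantumFields.YangMills.Theorems.BalabanUVNodesPortS1JacIntGauge
import Literature.MathematicalPhysics.QuantumFieldTheory.Balaban1983to89.B15AveragingHolomorphicLocalAnalytic

/-!
# NODE O port PT-A — `stub_LZjacDom`, PART 1: PTZ-1's ONE-STEP ROWS (a)(b) LOCALIZED TO THE COMPONENT BLOCK `jacBlockCt` — the holomorphic response of the COMPONENT map
# `W ↦ avgMh W c` in normal form under the polydisc condition AT `c` ONLY; `det A₁^ℂ(c)(W)` (trace-projected coordinates) within `r³∕2` of `r³ = (N_c∕|I|)³`; slit plane; the window-local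
# Jacobian factor analytic with `|jacFactorCt c W − log r³| ≤ 1` (companion file) — THIS FILE: the coordinate lemmas and the COMPONENT NORMAL FORM

Cell `ym-nodeO-ideate`, porter seat `ymgap-nodeO-port-PTA-1` (gen 7, lead of the line `pta-residueW` of 27930's skeleton); `--supports stmt-QuantumFields-27930` (helper).
[I] = [Balaban1987RG1], [B7] = [Balaban1985Averaging], [15] = [Balaban1985Variational].

WHY.  The registered stub `stub_LZjacDom : ∀ F, JacRowsABDom F` (✓ `…JacKStepDefs`) asks rows (a)(b) of the torus Jacobian functional `J_T(c, 𝐔) = jacFactorCt c (iterMh k 𝐔)` at fields that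
are tower-loop-small AT THE TOWER REGION OF `c` ONLY.  Porter PTZ-1's rows (✓p814103 `…JacobianHoloDomainDet.analyticAt_jacFactorC_of_loopSmall` ∕ `norm_jacFactorC_sub_log_le`) are stated
for gen 5's block `jacBlockC` — the `c`-component of the derivative of the WHOLE map `W ↦ avgMh W` — and therefore carry the polydisc hypothesis at EVERY coarse bond of the torus (the Pi-map must
be differentiable).  The line's formula objects use the COMPONENT block `jacBlockCt` (✓p814190: `fderiv ℂ (fun W ↦ avgMh W c)`, trace-projected coordinates `su2CoordCt`), which reads the window
of `c` only.  THIS FILE re-runs PTZ-1's two proofs for the component block: the ONLY change in the normal form (§2) is that the chain rule is applied to the component map, whose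
differentiability needs the loop matrices AT `c` in the polydisc (dag-n12-c's `B15AveragingHolomorphicLocal.differentiableAt_avgMh_apply`) — every other line is PTZ-1's, consumed by name
(file (A) `…JacobianHoloPrivate`: `loopMh_of_isCentral`, `holMh_openWord_update_of_not_isCentral`, `axialMh_update_centralBond`, `loopMh_eq_open_mul_adjugate`, `axialMh_eq_pre_mul_mul_post`;
✓p812756 `det_holMh_eq_one`, `det_update_exp_mul`; (B) `exists_clm_eq_adjugate`, `norm_centralResponseC_sub_le`, `one_sub_nonCentral_div_eq`; (C) `norm_adjugate_sub_one_le`, `norm_su2Gen`,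
`norm_det_sub_cube_le`, `su2CoordC_su2Gen`, `responseDir_sum_smul`, `isUnit_avgMh_of_det_eq_one`; gen 6 `su2CoordCt_*`, `det_adMatC_of_det_eq_one`).  The determinant hypothesis stays GLOBAL
(`∀ b, det W b = 1`): the tower file (PART 2) feeds the spliced field `W on the window, 1 elsewhere`.
* §1 `su2CoordCt_sub`, `su2CoordCt_su2Gen`, `norm_su2CoordCt_le`, `contDiff_su2CoordCt`.
* §2 ★★ `fderiv_avgMh_apply_single_centralBond_eq` — the COMPONENT response in normal form (polydisc at `c` only).
* (companion file `…JacDomLocalDet`, §3–§4) `norm_det_jacBlockCt_sub_le`, `det_jacBlockCt_mem_slitPlane`, `analyticAt_jacFactorCt_of_loopSmall` (ROW (a)), `norm_jacFactorCt_sub_log_le` (ROW (b)).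

HONEST FRAMING.  Kernel calculus ∕ algebra over the tree's own holomorphic (0.4) model, PTZ-1's landed one-step estimate and dag-n07-w2's (0.8) estimate; NOTHING of Bałaban's renormalization-group
estimates asserted, ported or discharged; `stub_LZjacDom` is closed in PART 2∕3 (tower assembly), `stub_LZdet` BLOCKED-ON P0 (α)+(β), `stub_FE` XXL; 27930 ⁸-Ax-LR4 OPEN · no claim; K0⁷∕K-Ax
OPEN; NODE O 0∕1; COUNT 8∕28 · K 1∕4 UNMOVED; finite `𝕋⁴_{L^K}` at fixed ε — NOT continuum ∕ OS ∕ Clay; **the Yang–Mills mass gap is NOT proved by any of this.**  No `sorry`, no `def`, no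
`instance`, no `notation`; standard axioms.
-/

noncomputable section

open scoped BigOperators Matrix.Norms.L2Operator Topology

namespace Summit.QuantumFields.YangMills.Theorems.BalabanUVNodesPortS1

open Summit.QuantumFields.YangMills.Theorems.K0RecordFormatNames
open Literature.MathematicalPhysics.QuantumFieldTheory.Balaban1983to89
open Literature.MathematicalPhysics.QuantumFieldTheory.Balaban1983to89.Node00
open Literature.MathematicalPhysics.QuantumFieldTheory.Balaban1983to89.T4Continuum
  (T4Family LStep walk walkEnd Letter)
open Literature.MathematicalPhysics.QuantumFieldTheory.Balaban1983to89.BlockAveraging (Idx off)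
open Literature.MathematicalPhysics.QuantumFieldTheory.Balaban1983to89.BlockAveragingHaarAC (centralBond IsCentral nCentral openWord)
open Literature.MathematicalPhysics.QuantumFieldTheory.Balaban1983to89.AveragingRT (lineSite)
open Literature.MathematicalPhysics.QuantumFieldTheory.Balaban1983to89.ExpMeanLog (eml eml_eq_exp differentiableAt_eml analyticAt_eml)
open Literature.MathematicalPhysics.QuantumFieldTheory.Balaban1983to89.BlockAveragingPlaquetteBound (norm_eml_sub_one_le_six_mul)
open Literature.MathematicalPhysics.QuantumFieldTheory.Balaban1983to89.B15AveragingHolomorphic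
open Literature.MathematicalPhysics.QuantumFieldTheory.Balaban1983to89.B15AveragingHolomorphicLocal (differentiableAt_avgMh_apply)
open Literature.MathematicalPhysics.QuantumFieldTheory.Balaban1983to89.B15AveragingHolomorphicLocalAnalytic (analyticAt_avgMh_apply)
open _root_.Matrix _root_.Filter

variable {P : Params} {j : ℕ}

/-! ## §1  Trace-projected coordinates: subtraction, the generators, the norm bound, smoothness -/

section Coord

/-- `su2CoordCt` respects subtraction. [folklore] -/
theorem su2CoordCt_sub (M N : MatA 2) (i : Fin 3) : su2CoordCt (M - N) i = su2CoordCt M i - su2CoordCt N i := by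
  fin_cases i <;> simp [su2CoordCt] <;> ring

/-- `su2CoordCt (su2Gen b) i = δ_{ib}` (the generators are traceless). [folklore] -/
theorem su2CoordCt_su2Gen (b i : Fin 3) : su2CoordCt (su2Gen b) i = if i = b then 1 else 0 := by
  rw [su2CoordCt_of_trace_eq_zero (trace_su2Gen b), su2CoordC_su2Gen]

/-- The projected coordinates are bounded by the operator norm: `|su2CoordCt Y i| ≤ ‖Y‖`. [folklore] -/
theorem norm_su2CoordCt_le (Y : MatA 2) (i : Fin 3) : ‖su2CoordCt Y i‖ ≤ ‖Y‖ := by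
  have h00 := norm_entry_le_norm Y 0 0
  have h11 := norm_entry_le_norm Y 1 1
  have h01 := norm_entry_le_norm Y 0 1
  have h10 := norm_entry_le_norm Y 1 0
  have h2 : ‖(2 : ℂ)‖ = 2 := by simp
  fin_cases i
  · show ‖-Complex.I * (Y 0 1 + Y 1 0) / 2‖ ≤ ‖Y‖
    rw [norm_div, norm_mul, norm_neg, Complex.norm_I, one_mul, h2]
    have : ‖Y 0 1 + Y 1 0‖ ≤ ‖Y‖ + ‖Y‖ := (norm_add_le _ _).trans (add_le_add h01 h10)
    linarith
  · show ‖(Y 0 1 - Y 1 0) / 2‖ ≤ ‖Y‖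
    rw [norm_div, h2]
    have : ‖Y 0 1 - Y 1 0‖ ≤ ‖Y‖ + ‖Y‖ := (norm_sub_le _ _).trans (add_le_add h01 h10)
    linarith
  · show ‖-Complex.I * (Y 0 0 - Y 1 1) / 2‖ ≤ ‖Y‖
    rw [norm_div, norm_mul, norm_neg, Complex.norm_I, one_mul, h2]
    have : ‖Y 0 0 - Y 1 1‖ ≤ ‖Y‖ + ‖Y‖ := (norm_sub_le _ _).trans (add_le_add h00 h11)
    linarith

/-- `su2CoordCt_i` is a continuous ℂ-linear function of the matrix (`C^ω`). [folklore] -/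
theorem contDiff_su2CoordCt (i : Fin 3) : ContDiff ℂ ⊤ (fun M : MatA 2 => su2CoordCt M i) := by
  have he : ∀ a b : Fin 2, ContDiff ℂ ⊤ (fun M : MatA 2 => M a b) := fun a b =>
    (LinearMap.toContinuousLinearMap (Matrix.entryLinearMap ℂ ℂ a b)).contDiff
  fin_cases i
  · show ContDiff ℂ ⊤ (fun M : MatA 2 => -Complex.I * (M 0 1 + M 1 0) / 2)
    exact ((contDiff_const.mul ((he 0 1).add (he 1 0))).div_const _)
  · show ContDiff ℂ ⊤ (fun M : MatA 2 => (M 0 1 - M 1 0) / 2)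
    exact (((he 0 1).sub (he 1 0))).div_const _
  · show ContDiff ℂ ⊤ (fun M : MatA 2 => -Complex.I * (M 0 0 - M 1 1) / 2)
    exact ((contDiff_const.mul ((he 0 0).sub (he 1 1))).div_const _)

end Coord

/-! ## §2  ★★ The response of the COMPONENT map `W ↦ avgMh W c` at the central bond, in normal form — polydisc condition at `c` only -/

/-- ★★ **THE HOLOMORPHIC RESPONSE OF THE COMPONENT MAP AT THE CENTRAL BOND IN NORMAL FORM.**  For an `SL(2,ℂ)`-valued field `W` whose (0.4) loop matrices AT `c` lie in the polydisc
`‖· − 1‖ < 1`, a traceless direction `X` at the central bond `β(c)`, `pre` the first half of the straight segment and `X̃ := pre·X·adj pre`: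
`D_ℂ(W ↦ avgMh W c)(W)[X·W(β)·δ_β] = D eml(loops)[i ↦ central ? 0 : −loop_i·X̃]·axialMh W c + eml(loops)·X̃·axialMh W c` — PTZ-1's `fderiv_avgMh_single_centralBond_eq` (✓p813988) for the
COMPONENT derivative: the chain rule is applied to `W ↦ avgMh W c`, differentiable under the condition at `c` alone (`B15AveragingHolomorphicLocal.differentiableAt_avgMh_apply`); the curve,
its normal form and the algebra are PTZ-1's, letter for letter. [cite: Balaban1987RG1, (0.4) p.253, p.267 («h(c)»); Balaban1985Variational, Prop. 9 p.309] -/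
theorem fderiv_avgMh_apply_single_centralBond_eq (hj : j + 1 ≤ P.m + P.K) (W : PBond P j → MatA 2) (hW : ∀ b, (W b).det = 1)
    (c : PBond P (j + 1)) (hpoly : ∀ i : Idx P, ‖loopMh W c i - 1‖ < 1) {X : MatA 2} (hX : X.trace = 0) :
    fderiv ℂ (fun W' : PBond P j → MatA 2 => avgMh W' c) W (Pi.single (centralBond c) (X * W (centralBond c))) =
      fderiv ℂ (eml : (Idx P → MatA 2) → MatA 2) (fun i => loopMh W c i)
          (fun i => if IsCentral c i then 0 else
            -(loopMh W c i * (holMh W (walk (emb c.src) (List.replicate ((P.L - 1) / 2) (c.dir, true))) * X *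
              (holMh W (walk (emb c.src) (List.replicate ((P.L - 1) / 2) (c.dir, true)))).adjugate))) * axialMh W c +
        eml (fun i => loopMh W c i) *
          ((holMh W (walk (emb c.src) (List.replicate ((P.L - 1) / 2) (c.dir, true))) * X *
              (holMh W (walk (emb c.src) (List.replicate ((P.L - 1) / 2) (c.dir, true)))).adjugate) * axialMh W c) := by
  classical
  letI : NormedAlgebra ℚ (MatA 2) := NormedAlgebra.restrictScalars ℚ ℂ (MatA 2)
  set β := centralBond c with hβ
  set pre := holMh W (walk (emb c.src) (List.replicate ((P.L - 1) / 2) (c.dir, true))) with hpre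
  set post := holMh W (walk (lineSite c ((P.L - 1) / 2 + 1)) (List.replicate ((P.L - 1) / 2) (c.dir, true))) with hpost
  set opn : Idx P → MatA 2 := fun i => holMh W (walk (emb c.src) (openWord P.L c.dir (off i.1) i.2.1 i.2.2)) with hopn
  set F₀ : Idx P → MatA 2 := fun i => loopMh W c i with hF₀
  have hdpre : pre.det = 1 := det_holMh_eq_one W hW _
  -- the curve and its velocity (the single-bond exponential curve)
  set γ : ℝ → PBond P j → MatA 2 := fun t b' => if b' = β then NormedSpace.exp (t • X) * W β else W b' with hγ
  have hγupd : ∀ t, γ t = Function.update W β (NormedSpace.exp (t • X) * W β) := fun t => by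
    funext b'
    rw [Function.update_apply]
  have hγ0 : γ 0 = W := by
    funext b'
    simp only [hγ, zero_smul, NormedSpace.exp_zero, one_mul]
    split_ifs with h
    · rw [h]
    · rfl
  have hexp : HasDerivAt (fun t : ℝ => NormedSpace.exp (t • X) * W β) (X * W β) 0 := by
    have hline : HasDerivAt (fun t : ℝ => t • X) X 0 := by simpa using (hasDerivAt_id (0 : ℝ)).smul_const X
    have he : HasFDerivAt (NormedSpace.exp : MatA 2 → MatA 2) ((1 : MatA 2 →L[ℂ] MatA 2).restrictScalars ℝ) ((fun t : ℝ => t • X) 0) := by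
      have e : (fun t : ℝ => t • X) 0 = 0 := zero_smul _ _
      rw [e]; exact (hasFDerivAt_exp_zero (𝕂 := ℂ)).restrictScalars ℝ
    exact (he.comp_hasDerivAt (0 : ℝ) hline).mul_const (W β)
  have hγd : HasDerivAt γ (Pi.single β (X * W β)) 0 := by
    refine hasDerivAt_pi.2 fun b' => ?_
    by_cases hb : b' = β
    · subst hb
      simp only [hγ, if_true, Pi.single_eq_same]
      exact hexp
    · simp only [hγ, hb, if_false, Pi.single_eq_of_ne hb]
      exact hasDerivAt_const _ _
  have hdetγ : ∀ t b, (γ t b).det = 1 := fun t b => det_update_exp_mul W hW β hX t b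
  -- the (L) derivative: the holomorphic response OF THE COMPONENT MAP (differentiable under the condition at `c` alone)
  have hM : HasFDerivAt (fun W' : PBond P j → MatA 2 => avgMh W' c)
      ((fderiv ℂ (fun W' : PBond P j → MatA 2 => avgMh W' c) W).restrictScalars ℝ) (γ 0) := by
    rw [hγ0]; exact (differentiableAt_avgMh_apply c hpoly).hasFDerivAt.restrictScalars ℝ
  have hA : HasDerivAt (fun t : ℝ => avgMh (γ t) c)
      (fderiv ℂ (fun W' : PBond P j → MatA 2 => avgMh W' c) W (Pi.single β (X * W β))) 0 :=
    hM.comp_hasDerivAt (0 : ℝ) hγd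
  -- the normal form along the curve (PTZ-1's file (A))
  set Mx : ℝ → MatA 2 := fun t => pre * (NormedSpace.exp (t • X) * W β) * post with hMx
  set F : ℝ → Idx P → MatA 2 := fun t i => if IsCentral c i then 1 else opn i * (Mx t).adjugate with hF
  have hax : ∀ t, axialMh (γ t) c = Mx t := fun t => by
    rw [hγupd t, axialMh_update_centralBond hj]
  have hloop : ∀ t i, loopMh (γ t) c i = F t i := fun t i => by
    by_cases hc : IsCentral c i
    · simp only [hF, hc, if_true]
      exact loopMh_of_isCentral (γ t) (hdetγ t) c i hc
    · simp only [hF, hc, if_false]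
      rw [loopMh_eq_open_mul_adjugate, hax t, hγupd t, holMh_openWord_update_of_not_isCentral hj W c i hc]
  have hnf : (fun t : ℝ => avgMh (γ t) c) = fun t => eml (F t) * Mx t := by
    funext t
    show corrMh (γ t) c * axialMh (γ t) c = _
    rw [hax t]
    unfold corrMh
    rw [show (fun i : Idx P => loopMh (γ t) c i) = F t from funext (hloop t)]
  have hF0 : F 0 = F₀ := by
    funext i; rw [← hloop 0 i, hγ0]
  have hMx0 : Mx 0 = axialMh W c := by rw [← hax 0, hγ0]
  -- the (R) derivative: normal form calculus
  have hMxd : HasDerivAt Mx (pre * (X * W β) * post) 0 := (hexp.const_mul pre).mul_const post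
  obtain ⟨T, hT⟩ := exists_clm_eq_adjugate
  have hadjd : HasDerivAt (fun t => (Mx t).adjugate) ((pre * (X * W β) * post).adjugate) 0 := by
    have h := T.hasFDerivAt.comp_hasDerivAt (0 : ℝ) hMxd
    rw [hT] at h
    refine h.congr_of_eventuallyEq (Filter.Eventually.of_forall fun t => ?_)
    exact (hT (Mx t)).symm
  have hFd : HasDerivAt F (fun i => if IsCentral c i then (0 : MatA 2) else opn i * (pre * (X * W β) * post).adjugate) 0 := by
    refine hasDerivAt_pi.2 fun i => ?_
    by_cases hc : IsCentral c i
    · simp only [hF, hc, if_true]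
      exact hasDerivAt_const _ _
    · simp only [hF, hc, if_false]
      exact hadjd.const_mul (opn i)
  have heml : HasFDerivAt (eml : (Idx P → MatA 2) → MatA 2)
      ((fderiv ℂ (eml : (Idx P → MatA 2) → MatA 2) F₀).restrictScalars ℝ) (F 0) := by
    rw [hF0]; exact (differentiableAt_eml hpoly).hasFDerivAt.restrictScalars ℝ
  have hB : HasDerivAt (fun t : ℝ => eml (F t) * Mx t)
      (fderiv ℂ (eml : (Idx P → MatA 2) → MatA 2) F₀ (fun i => if IsCentral c i then (0 : MatA 2) else opn i * (pre * (X * W β) * post).adjugate) * Mx 0 +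
        eml (F 0) * (pre * (X * W β) * post)) 0 :=
    (heml.comp_hasDerivAt (0 : ℝ) hFd).mul hMxd
  rw [hnf] at hA
  have huniq := hA.unique hB
  rw [huniq, hF0, hMx0]
  -- algebra: `adj(pre·X·W(β)·post) = −adj post·adj W(β)·X·adj pre`, `open_i·adj post·adj W(β) = loop_i·pre`
  have hadjX : X.adjugate = -X := by rw [adjugate_eq_trace_smul_one_sub, hX, zero_smul, zero_sub]
  have hkey : ∀ i, ¬ IsCentral c i → opn i * (pre * (X * W β) * post).adjugate = -(F₀ i * (pre * X * pre.adjugate)) := by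
    intro i hc
    have hFi : F₀ i = opn i * (post.adjugate * (W β).adjugate * pre.adjugate) := by
      simp only [hF₀]
      rw [loopMh_eq_open_mul_adjugate, axialMh_eq_pre_mul_mul_post, Matrix.adjugate_mul_distrib, Matrix.adjugate_mul_distrib, mul_assoc]
    rw [hFi, Matrix.adjugate_mul_distrib, Matrix.adjugate_mul_distrib, Matrix.adjugate_mul_distrib, hadjX]
    calc opn i * (post.adjugate * ((W β).adjugate * -X * pre.adjugate))
        = -(opn i * post.adjugate * (W β).adjugate * (pre.adjugate * pre) * X * pre.adjugate) := by
          rw [adjugate_mul_self_of_det_eq_one hdpre]; noncomm_ring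
      _ = -(opn i * (post.adjugate * (W β).adjugate * pre.adjugate) * (pre * X * pre.adjugate)) := by noncomm_ring
  have hdir : (fun i => if IsCentral c i then (0 : MatA 2) else opn i * (pre * (X * W β) * post).adjugate) =
      fun i => if IsCentral c i then 0 else -(F₀ i * (pre * X * pre.adjugate)) := by
    funext i
    by_cases hc : IsCentral c i
    · simp only [hc, if_true]
    · simp only [hc, if_false]; exact hkey i hc
  have hsec : pre * (X * W β) * post = pre * X * pre.adjugate * axialMh W c := by
    rw [axialMh_eq_pre_mul_mul_post]
    calc pre * (X * W β) * post = pre * X * (pre.adjugate * pre) * W β * post := by rw [adjugate_mul_self_of_det_eq_one hdpre]; noncomm_ring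
      _ = _ := by noncomm_ring
  rw [hdir, hsec]

end Summit.QuantumFields.YangMills.Theorems.BalabanUVNodesPortS1

end
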